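import Summits.QuantumFields.YangMills.Theorems.BalabanUVNodesN26AtRecord13
import Literature.MathematicalPhysics.QuantumFieldTheory.Balaban1983to89.Node00.Record13LiveSelectorFamily

/-!
# DAG node N26 — N1 AT THE FAITHFUL STAGE-13 LETTERS AND THE (D4) FAMILY ROAD AT NODE 00's OPEN-LETTER WITNESS FAMILY
# `θ₁₃(ε₀, ε₂₉) = Node00.theta13LiveOfFamily₂ F N ε₀ ε₂₉ ζ Rz Zt` (K0a FILE 9): the (2.9) threshold `ε₂₉` an OPEN letter bounded by the record's κ–ε₁ small row,
# the row and K0e's hierarchy room `4ε₂₉ < ε₀` jointly inhabitable in the family, the located negative at the pinned member of record `(1, ⅛)`, the all-numerics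
# family, and B4 ∕ N26 at `betaOfRecord₁₃ θ₁₃(ε₀, ε₂₉)` from the family road with N1 discharged modulo the displayed `ε₂₉`-inequality

Cell `pub-ymgap`, YM-PLAN Track A (HUMAN RULING D-0062), seat `pub-ymgap-dag-n26-c` gen 6 (R134 acceleration seat, s2); helper for crux K2‴ `EndpointGivenBR13`
(stmt-QuantumFields-19911, route `BalabanUVNodes` rev 16).  dag-lead's RECORD13 gate row N1 «one example at θ₁₃», CONSUMER SIDE; dag-ref-D READ-148 READ RULE («the ₁₃ N1 ∕ (D4)
rows must be stated at a θ whose `ε₂₉` is an OPEN letter bounded by the small row; nothing hypothesised on the faithful `CondsL` AT `theta13LiveOfRecord`, vacuous there»);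
node00-def-K0a FILE 9 `Node00/Record13LiveSelectorFamily` («the (D4) ∕ N26 ∕ N1-small consumers instantiate AT THE FAMILY with `hsmall : ε₂₉ ≤ …` DISPLAYED, never at a numeral»).

WHAT IS HERE (0 `def`, 0 `sorry`; kernel numerals + compositions BY NAME over this seat's `…N26AtRecord13` (p491248) §1b ∕ §3 and `…N26AtRecord12KappaSufficient` (p485881) §1).
§0 `C3act_c13OfRecord₁₂_faithful_eq` (`rfl`: `C₃` reads no `ε₁`, the bridge behind p491248 §3's right-hand sides).
§1 N1 `CondsL 4 (c13OfRecord₁₂ θ₁₃.toStage12Params { c₀ with ε₁ := ε₂₉ }) (½L)` AT THE FAITHFUL LETTERS OF `θ₁₃(ε₀, ε₂₉)` (κ = 2·10⁴, `E₀ = 1`, `L = F.L`, all `rfl` ∕ by name):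
`kappaThreshold_le_theta13LiveOfFamily₂` (both κ rows paid), `C3act_c13OfRecord₁₂_theta13LiveOfFamily₂` (`C₃ = 2(F.L+2)⁴·A₁·K₀(c₀)`), `condsL_faithful_theta13LiveOfFamily₂_iff`
(N1 ⟺ [`2(F.L+2)⁴·A₁·K₀(c₀)·ε₂₉·e^{100001}·K₀(64,8)·576 ≤ 1`] ∧ [`e·576·K₀(64,8)² ≤ A₂`]), `condsL_faithful_theta13LiveOfFamily₂_iff_eps_le` (the small row AS `ε₂₉ ≤ 1 ∕ (…)`),
`condsL_faithful_theta13LiveOfFamily₂_of_eps_le` (the USE form: K0a's displayed `hsmall` and the residual O(1) `hA₂` ⟹ N1).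
§1b `exists_eps29_condsL_faithful_theta13LiveOfFamily₂`: for every `ε₀ > 0` and residual `c₀` SOME `ε₂₉ > 0` with `4ε₂₉ < ε₀` meets N1 at the faithful letters of `θ₁₃(ε₀, ε₂₉)`
(with the minimal `A₂`) — the faithful row and K0e's hierarchy ordering are JOINTLY inhabitable IN THE FAMILY (the honest answer to ⚑ EPS-PIN: choose `ε₂₉` after `ε₀` and `c₀`).
§1c THE LOCATED NEGATIVE AT THE PINNED MEMBER OF RECORD `theta13LiveOfRecord = θ₁₃(1, ⅛)` (`rfl`, K0a's `theta13LiveOfRecord_eq_family₂`): `condsL_faithful_theta13LiveOfRecord_iff`,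
`not_condsL_faithful_theta13LiveOfRecord (hAK : 1 ≤ c₀.A₁·K₀(c₀))` — dag-ref-D's desk certificate (READ-148, `RefDProbeP488983`) BY NAME in the tree; the ₁₃ twin of p479720's
`not_condsL_c13OfRecord₁₂_theta12OfRecord`.  It voids nothing at the family: the members below the threshold are where the road applies (§1b shows they exist).
§2 THE ALL-NUMERICS FAMILY `theta13LiveOfNumerics F N n ε₂₉ ζ Rz Zt` (every numeric letter an argument): `condsL_faithful_theta13LiveOfNumerics_iff_of_kappa_ge` — given the κ threshold
on `n`, N1 at the faithful letters is the small row in `(F.L, n.s2.lf.E₀, n.s2.lf.κ, A₁, K₀(c₀), ε₂₉)` ∧ the `A₂` row.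
§3 THE (D4) FAMILY ROAD AT THE FAMILY WITNESS (p491248 §1b at `θ := θ₁₃(ε₀, ε₂₉)`, faithful `c₀`, N1 DISCHARGED modulo the displayed `hsmall`, `hA₂`; box `γ₀ ≤ ½ = θ₁₃.γ`):
`betaContH_betaOfRecord₁₃_theta13LiveOfFamily₂_of_family` (B4 on the box at `betaOfRecord₁₃ θ₁₃(ε₀, ε₂₉)`), `n26_datumOfRecord₁₃_theta13LiveOfFamily₂_of_family` (N26 at the family
witness's datum of record) ⇐ the Stage-12 [B13] family of record at `θ₁₃.toStage12Params` with the (1.22) identification at the ₁₃ merged β, the member letters law + N10's family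
leaf, run sequences ∕ laws ∕ restriction sentences, N3 (`SignsL`, `Valid`), the (4.4) seams with holomorphic activities, the (190) ∕ (1.7) data, `hsmall`, `hA₂`, (C-pt).

HONEST FRAMING.  Count-neutral; kernel numerals over NODE 00's definitions and by-name knit; nothing of Bałaban's is constructed or estimated.  (D4) INSTANCE 0∕1 (every family ∕
(1.22) ∕ law ∕ seam ∕ (190) ∕ (1.7) ∕ N3 ∕ (C-pt) input of §3 is a displayed HYPOTHESIS on the record's residual objects); N25 ∕ N26 NOT discharged; counts unmoved.  The family road
covers the members `θ₁₃(ε₀, ε₂₉)` with `ε₂₉` BELOW the small-row threshold only (§1 ∕ §1c): crux K2‴ quantifies over EVERY admissible θ, and at members above the threshold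
(e.g. the pinned member of record) this road says nothing — displayed, not repaired, here.  One finite four-torus programme at fixed ε per run — NOT the continuum limit, NOT ℝ⁴,
NOT OS, NOT a mass gap, NOT Clay.  No `instance`, no `notation`, no `axiom`.
Sources (context): [I] = [Balaban1987RG1] CMP **109** (1987): (1.2) p. 260, (1.7) p. 261, (1.18) p. 263, (1.20)–(1.22) p. 264, (2.9) p. 266, (5.10) p. 293;
[II] = [Balaban1988RG2Cluster] CMP **116** (1988): p. 7 (after (1.21)), (1.26) p. 8, Lemma 3 (2.38) p. 20, p. 21 (after (2.39), after (2.41));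
[III] = [Balaban1988Convergent] CMP **119** (1988): (2.10) p. 256, p. 265; [Balaban1989LargeFieldI] CMP **122** (1989): (0.3) p. 176.
-/

noncomputable section

open scoped Matrix.Norms.L2Operator

namespace Summit.QuantumFields.YangMills.Theorems.BalabanUVNodesN26AtRecord13Family

open Literature.MathematicalPhysics.QuantumFieldTheory.Balaban1983to89
open Literature.MathematicalPhysics.QuantumFieldTheory.Balaban1983to89.FlowStep
open Literature.MathematicalPhysics.QuantumFieldTheory.Balaban1983to89.T4Continuum (T4Family)
open Literature.MathematicalPhysics.QuantumFieldTheory.Balaban1983to89.Node00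
open Literature.MathematicalPhysics.QuantumFieldTheory.Balaban1983to89.B13ScaleTransfer (Pt)
open Literature.MathematicalPhysics.QuantumFieldTheory.Balaban1983to89.B12TreeDecay (K₀ K₀_pos)
open Literature.MathematicalPhysics.QuantumFieldTheory.Balaban1983to89.Beta.RemainderChainLattice
open Literature.MathematicalPhysics.QuantumFieldTheory.Balaban1983to89.TreeLengthTorus (TDom proj)
open Literature.MathematicalPhysics.QuantumFieldTheory.Balaban1983to89.B12Decay510 (mixedDeriv)
open Literature.MathematicalPhysics.QuantumFieldTheory.Balaban1983to89.Beta.RemainderLimitTorus (LDom limKernel tproj)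
open Literature.MathematicalPhysics.QuantumFieldTheory.Balaban1983to89.Beta.RemainderWOfRecordB13
open Literature.MathematicalPhysics.QuantumFieldTheory.Balaban1983to89.Beta.RemainderDecay190
open Summit.QuantumFields.BalabanUV.Gaps
open Summit.QuantumFields.YangMills.Theorems.BalabanUVNodesN26AtRecord12KappaSufficient
  (C3act_c13OfRecord₁₂ condsL_c13OfRecord₁₂_half_iff_of_kappa_ge kappaThreshold_le_2e4)
open Summit.QuantumFields.YangMills.Theorems.BalabanUVNodesN26AtRecord13 (betaContH_betaOfRecord₁₃_of_family)
open Metric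
open Filter Topology

variable (F : T4Family) (N : ℕ) [NeZero N]

/-- **Lemma 3's activity constant reads no `ε₁`**: at the faithful Stage-13 letters `{ c₀ with ε₁ := θ.ε₂₉ }` it IS the one at `c₀` (`rfl`; `C₃ = 2(L+2)⁴·A₁·(E₀·K₀(c₀))`) — the bridge
behind p491248's `condsL_faithful_stage13_iff_of_kappa_ge`, whose right-hand side writes `C3act` at `c₀` (dag-ref-D READ-156 nit (n2)). [cite: Balaban1988RG2Cluster, p.20 (definition of C₃; bookkeeping)] -/
theorem C3act_c13OfRecord₁₂_faithful_eq (θ : Stage13Params F N) (c₀ : B13.Consts) :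
    (c13OfRecord₁₂ F N θ.toStage12Params { c₀ with ε₁ := θ.ε₂₉ }).C3act = (c13OfRecord₁₂ F N θ.toStage12Params c₀).C3act := rfl

/-! ## §1 N1 at the faithful Stage-13 letters OF THE OPEN-LETTER FAMILY `θ₁₃(ε₀, ε₂₉)`: both κ rows paid by `κ = 2·10⁴`; left, the small row in `ε₂₉` and the `A₂` row -/

section Family2

variable (ε₀ ε₂₉ : ℝ) (ζ : ZetaOfRecord F N (numerics7OfFamily ε₀) 1) (Rz : (K : ℕ) → Sect2.Residual (F.P K) (MatA N))
  (Zt : (K : ℕ) → TkResidualW F N (FluctV N) K) (c₀ : B13.Consts)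

/-- The record-side κ threshold `20·(64·log 162 + 1)` (≈ 6532) holds at every member `θ₁₃(ε₀, ε₂₉)` (K0a's `kp_n10_theta13LiveOfFamily₂`: `2·10⁴ ≤ κ`).
[cite: Balaban1988RG2Cluster, p.21 (after (2.39)); Balaban1987RG1, (1.18) p.263 (bookkeeping numeral)] -/
theorem kappaThreshold_le_theta13LiveOfFamily₂ :
    20 * (64 * Real.log 162 + 1) ≤ (theta13LiveOfFamily₂ F N ε₀ ε₂₉ ζ Rz Zt).s2.lf.κ :=
  kappaThreshold_le_2e4.trans (kp_n10_theta13LiveOfFamily₂ F N ε₀ ε₂₉ ζ Rz Zt)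

/-- **Face: Lemma 3's activity constant at the letters of record OF `θ₁₃(ε₀, ε₂₉)`** (`L = F.L`, `E₀ = 1`): `C₃ = 2(F.L+2)⁴·A₁·K₀(c₀)` — the family's block size and the residual
letters `A₁`, `K₀(c₀) = 2C₁α₄⁻¹α₆⁻¹M^q e^{C₂κ₁}` only (independent of `ε₀`, `ε₂₉`). [cite: Balaban1988RG2Cluster, p.20 (definition of C₃; bookkeeping numeral); Balaban1987RG1, (0.1) p.251] -/
theorem C3act_c13OfRecord₁₂_theta13LiveOfFamily₂ :
    (c13OfRecord₁₂ F N (theta13LiveOfFamily₂ F N ε₀ ε₂₉ ζ Rz Zt).toStage12Params c₀).C3act = 2 * ((F.L : ℝ) + 2) ^ 4 * c₀.A₁ * c₀.K₀ := by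
  rw [C3act_c13OfRecord₁₂, show (theta13LiveOfFamily₂ F N ε₀ ε₂₉ ζ Rz Zt).toStage12Params.ℓ₆ + 1 = F.L from
      theta13LiveOfFamily₂_ℓ₆_succ F N ε₀ ε₂₉ ζ Rz Zt,
    show (theta13LiveOfFamily₂ F N ε₀ ε₂₉ ζ Rz Zt).toStage12Params.s2.lf.E₀ = 1 from rfl]
  ring

/-- **N1 AT THE FAITHFUL STAGE-13 LETTERS OF THE MEMBER `θ₁₃(ε₀, ε₂₉)` IS THE SMALL ROW IN `ε₂₉` AND THE `A₂` ROW** — both κ rows DISCHARGED by the family numeral `κ = 2·10⁴`: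
`CondsL 4 (c13OfRecord₁₂ θ₁₃.toStage12Params { c₀ with ε₁ := ε₂₉ }) (½L)` ⟺ [`2(F.L+2)⁴·A₁·K₀(c₀)·ε₂₉·e^{100001}·K₀(64,8)·576 ≤ 1`] ∧ [`e·576·K₀(64,8)² ≤ A₂`].  The (2.9) threshold
is an OPEN letter here (dag-ref-D READ-148's sanctioned shape); what «ε₁ sufficiently small» ([II] p. 21) costs at this κ is displayed.
[cite: Balaban1988RG2Cluster, p.7 (after (1.21)), p.21 (after (2.39): «for κ sufficiently large, and ε₁ sufficiently small»; after (2.41)); Balaban1987RG1, (1.18) p.263 and (2.9) p.266] -/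
theorem condsL_faithful_theta13LiveOfFamily₂_iff :
    CondsL 4 (c13OfRecord₁₂ F N (theta13LiveOfFamily₂ F N ε₀ ε₂₉ ζ Rz Zt).toStage12Params { c₀ with ε₁ := ε₂₉ })
        (((c13OfRecord₁₂ F N (theta13LiveOfFamily₂ F N ε₀ ε₂₉ ζ Rz Zt).toStage12Params { c₀ with ε₁ := ε₂₉ }).L : ℝ) / 2) ↔
      2 * ((F.L : ℝ) + 2) ^ 4 * c₀.A₁ * c₀.K₀ * ε₂₉ * Real.exp (5 * 20000 + 1) * K₀ 64 8 * 9 * 64 ≤ 1 ∧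
        Real.exp 1 * 9 * 64 * K₀ 64 8 ^ 2 ≤ c₀.A₂ := by
  rw [condsL_c13OfRecord₁₂_half_iff_of_kappa_ge F N _ _ (kappaThreshold_le_theta13LiveOfFamily₂ F N ε₀ ε₂₉ ζ Rz Zt),
    show (c13OfRecord₁₂ F N (theta13LiveOfFamily₂ F N ε₀ ε₂₉ ζ Rz Zt).toStage12Params { c₀ with ε₁ := ε₂₉ }).C3act =
        (c13OfRecord₁₂ F N (theta13LiveOfFamily₂ F N ε₀ ε₂₉ ζ Rz Zt).toStage12Params c₀).C3act from rfl,
    C3act_c13OfRecord₁₂_theta13LiveOfFamily₂, theta13LiveOfFamily₂_κ]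

/-- **THE SMALL ROW AS THE INEQUALITY ON THE OPEN LETTER** (for `A₁·K₀(c₀) > 0`): N1 at the faithful letters of `θ₁₃(ε₀, ε₂₉)` ⟺
[`ε₂₉ ≤ 1 ∕ (2(F.L+2)⁴·A₁·K₀(c₀)·e^{100001}·K₀(64,8)·576)`] ∧ [`e·576·K₀(64,8)² ≤ A₂`] — the `hsmall : ε₂₉ ≤ …` K0a's FILE 9 asks the consumers to display.
[cite: Balaban1988RG2Cluster, p.7 (after (1.21)) and p.21 (after (2.39)); Balaban1987RG1, (2.9) p.266] -/
theorem condsL_faithful_theta13LiveOfFamily₂_iff_eps_le (hP : 0 < c₀.A₁ * c₀.K₀) :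
    CondsL 4 (c13OfRecord₁₂ F N (theta13LiveOfFamily₂ F N ε₀ ε₂₉ ζ Rz Zt).toStage12Params { c₀ with ε₁ := ε₂₉ })
        (((c13OfRecord₁₂ F N (theta13LiveOfFamily₂ F N ε₀ ε₂₉ ζ Rz Zt).toStage12Params { c₀ with ε₁ := ε₂₉ }).L : ℝ) / 2) ↔
      ε₂₉ ≤ 1 / (2 * ((F.L : ℝ) + 2) ^ 4 * c₀.A₁ * c₀.K₀ * Real.exp (5 * 20000 + 1) * K₀ 64 8 * 9 * 64) ∧
        Real.exp 1 * 9 * 64 * K₀ 64 8 ^ 2 ≤ c₀.A₂ := by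
  rw [condsL_faithful_theta13LiveOfFamily₂_iff]
  have hK := K₀_pos 64 8
  have hpos : 0 < 2 * ((F.L : ℝ) + 2) ^ 4 * c₀.A₁ * c₀.K₀ * Real.exp (5 * 20000 + 1) * K₀ 64 8 * 9 * 64 := by
    have h1 : 0 < 2 * ((F.L : ℝ) + 2) ^ 4 * (c₀.A₁ * c₀.K₀) := by positivity
    have e : 2 * ((F.L : ℝ) + 2) ^ 4 * c₀.A₁ * c₀.K₀ = 2 * ((F.L : ℝ) + 2) ^ 4 * (c₀.A₁ * c₀.K₀) := by ring
    rw [e]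
    positivity
  rw [le_div_iff₀ hpos]
  have e : ε₂₉ * (2 * ((F.L : ℝ) + 2) ^ 4 * c₀.A₁ * c₀.K₀ * Real.exp (5 * 20000 + 1) * K₀ 64 8 * 9 * 64) =
      2 * ((F.L : ℝ) + 2) ^ 4 * c₀.A₁ * c₀.K₀ * ε₂₉ * Real.exp (5 * 20000 + 1) * K₀ 64 8 * 9 * 64 := by ring
  rw [e]

variable {ε₂₉ c₀} in
/-- **USE FORM — N1 AT THE FAITHFUL LETTERS OF `θ₁₃(ε₀, ε₂₉)` FROM THE TWO DISPLAYED INEQUALITIES** `hsmall` (the open letter below the threshold) and `hA₂` (the printed O(1) of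
(2.41) at least `e·576·K₀(64,8)²`): the `hC` slot of every ₁₂ ∕ ₁₃ family-road theorem of this lineage at the member, discharged modulo them.
[cite: Balaban1988RG2Cluster, p.21 (after (2.39) and after (2.41)); Balaban1987RG1, (1.18) p.263 and (2.9) p.266] -/
theorem condsL_faithful_theta13LiveOfFamily₂_of_eps_le
    (hsmall : 2 * ((F.L : ℝ) + 2) ^ 4 * c₀.A₁ * c₀.K₀ * ε₂₉ * Real.exp (5 * 20000 + 1) * K₀ 64 8 * 9 * 64 ≤ 1)
    (hA₂ : Real.exp 1 * 9 * 64 * K₀ 64 8 ^ 2 ≤ c₀.A₂) :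
    CondsL 4 (c13OfRecord₁₂ F N (theta13LiveOfFamily₂ F N ε₀ ε₂₉ ζ Rz Zt).toStage12Params { c₀ with ε₁ := ε₂₉ })
      (((c13OfRecord₁₂ F N (theta13LiveOfFamily₂ F N ε₀ ε₂₉ ζ Rz Zt).toStage12Params { c₀ with ε₁ := ε₂₉ }).L : ℝ) / 2) :=
  (condsL_faithful_theta13LiveOfFamily₂_iff F N ε₀ ε₂₉ ζ Rz Zt c₀).2 ⟨hsmall, hA₂⟩

/-! ## §1b Non-vacuity JOINT with the (2.9) hierarchy room: `ε₂₉` chosen after `ε₀` and `c₀` -/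

variable {ε₀} in
/-- **THE FAITHFUL ROW AND THE HIERARCHY ORDERING ARE JOINTLY INHABITABLE IN THE FAMILY**: for every `ε₀ > 0` and residual `c₀` there is a threshold `ε₂₉ > 0` with `4ε₂₉ < ε₀`
(K0e's `δ + 4ε₂₉ ≤ ε₀` room for every `δ ≤ ε₀ − 4ε₂₉`) at which N1 holds at the faithful letters of `θ₁₃(ε₀, ε₂₉)` with the minimal `A₂` — namely any
`ε₂₉ ≤ min(ε₀ ∕ 8, 1 ∕ (|2(F.L+2)⁴·A₁·K₀(c₀)·e^{100001}·K₀(64,8)·576| + 1))`.  (Satisfiability of the two displayed inequalities together; nothing of Bałaban's; the other displayed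
inputs of the family road are untouched.) [cite: Balaban1987RG1, (1.2) p.260 and (2.9) p.266; Balaban1988Convergent, p.265; Balaban1988RG2Cluster, p.21 (after (2.39) and after (2.41))] -/
theorem exists_eps29_condsL_faithful_theta13LiveOfFamily₂ (hε : 0 < ε₀) :
    ∃ ε₂₉ : ℝ, 0 < ε₂₉ ∧ 4 * ε₂₉ < ε₀ ∧
      CondsL 4 (c13OfRecord₁₂ F N (theta13LiveOfFamily₂ F N ε₀ ε₂₉ ζ Rz Zt).toStage12Params
          { c₀ with ε₁ := ε₂₉, A₂ := Real.exp 1 * 9 * 64 * K₀ 64 8 ^ 2 })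
        (((c13OfRecord₁₂ F N (theta13LiveOfFamily₂ F N ε₀ ε₂₉ ζ Rz Zt).toStage12Params
          { c₀ with ε₁ := ε₂₉, A₂ := Real.exp 1 * 9 * 64 * K₀ 64 8 ^ 2 }).L : ℝ) / 2) := by
  set P : ℝ := 2 * ((F.L : ℝ) + 2) ^ 4 * c₀.A₁ * c₀.K₀ * Real.exp (5 * 20000 + 1) * K₀ 64 8 * 9 * 64 with hP
  refine ⟨min (ε₀ / 8) (1 / (|P| + 1)), lt_min (by positivity) (by positivity), ?_, ?_⟩
  · have h := min_le_left (ε₀ / 8) (1 / (|P| + 1))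
    linarith
  · refine condsL_faithful_theta13LiveOfFamily₂_of_eps_le F N ε₀ ζ Rz Zt
      (c₀ := { c₀ with A₂ := Real.exp 1 * 9 * 64 * K₀ 64 8 ^ 2 }) ?_ le_rfl
    show 2 * ((F.L : ℝ) + 2) ^ 4 * c₀.A₁ * c₀.K₀ * min (ε₀ / 8) (1 / (|P| + 1)) * Real.exp (5 * 20000 + 1) * K₀ 64 8 * 9 * 64 ≤ 1
    have hm0 : 0 ≤ min (ε₀ / 8) (1 / (|P| + 1)) := le_min (by positivity) (by positivity)
    have hm1 : min (ε₀ / 8) (1 / (|P| + 1)) ≤ 1 / (|P| + 1) := min_le_right _ _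
    have e : 2 * ((F.L : ℝ) + 2) ^ 4 * c₀.A₁ * c₀.K₀ * min (ε₀ / 8) (1 / (|P| + 1)) * Real.exp (5 * 20000 + 1) * K₀ 64 8 * 9 * 64 =
        P * min (ε₀ / 8) (1 / (|P| + 1)) := by rw [hP]; ring
    rw [e]
    calc P * min (ε₀ / 8) (1 / (|P| + 1)) ≤ |P| * min (ε₀ / 8) (1 / (|P| + 1)) :=
          mul_le_mul_of_nonneg_right (le_abs_self P) hm0
      _ ≤ |P| * (1 / (|P| + 1)) := mul_le_mul_of_nonneg_left hm1 (abs_nonneg P)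
      _ = |P| / (|P| + 1) := by ring
      _ ≤ 1 := by rw [div_le_one (by positivity)]; linarith

end Family2

/-! ## §1c The located negative at the PINNED member of record `theta13LiveOfRecord = θ₁₃(1, ⅛)` (dag-ref-D READ-148's certificate, by name) -/

section RecordMember

variable (c₀ : B13.Consts)

/-- `2 ≤ log 162` (`e² < 7.39 < 162`). [cite: Balaban1988RG2Cluster, (1.26) p.8 (bookkeeping numeral)] -/
theorem two_le_log_162 : 2 ≤ Real.log 162 := by
  rw [Real.le_log_iff_exp_le (by norm_num)]
  have h1 := Real.exp_one_lt_d9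
  have h0 := Real.exp_pos 1
  have e : Real.exp 2 = Real.exp 1 * Real.exp 1 := by rw [← Real.exp_add]; norm_num
  rw [e]
  nlinarith

/-- `1 ≤ K₀(64, 8) = e^{64·log 162} ∕ 81`. [cite: Balaban1988RG2Cluster, (1.26) p.8 (bookkeeping numeral)] -/
theorem one_le_K₀_64_8 : 1 ≤ K₀ 64 8 := by
  unfold K₀ B12TreeDecay.kappa₀ B12TreeDecay.a₀
  have ha : Real.log (2 * (((8 : ℕ) : ℝ) + 1) ^ 2) = Real.log 162 := by norm_num
  rw [ha, le_div_iff₀ (by positivity)]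
  have h := Real.add_one_le_exp (64 * Real.log 162)
  have h2 := two_le_log_162
  norm_num
  linarith

/-- **N1 AT THE FAITHFUL LETTERS OF THE PINNED MEMBER OF RECORD** `theta13LiveOfRecord = θ₁₃(1, ⅛)` (`rfl`): the rows with `ε₂₉ = ⅛` INSIDE —
[`2(F.L+2)⁴·A₁·K₀(c₀)·⅛·e^{100001}·K₀(64,8)·576 ≤ 1`] ∧ [`e·576·K₀(64,8)² ≤ A₂`].  A certificate about the pinned member, NOT a hypothesis of anything here.
[cite: Balaban1988RG2Cluster, p.21 (after (2.39) and after (2.41)); Balaban1987RG1, (1.2) p.260, (1.18) p.263 and (2.9) p.266] -/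
theorem condsL_faithful_theta13LiveOfRecord_iff :
    CondsL 4 (c13OfRecord₁₂ F N (theta13LiveOfRecord F N).toStage12Params { c₀ with ε₁ := (theta13LiveOfRecord F N).ε₂₉ })
        (((c13OfRecord₁₂ F N (theta13LiveOfRecord F N).toStage12Params { c₀ with ε₁ := (theta13LiveOfRecord F N).ε₂₉ }).L : ℝ) / 2) ↔
      2 * ((F.L : ℝ) + 2) ^ 4 * c₀.A₁ * c₀.K₀ * (1 / 8) * Real.exp (5 * 20000 + 1) * K₀ 64 8 * 9 * 64 ≤ 1 ∧
        Real.exp 1 * 9 * 64 * K₀ 64 8 ^ 2 ≤ c₀.A₂ := by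
  rw [theta13LiveOfRecord_eq_family₂, theta13LiveOfFamily₂_ε₂₉, condsL_faithful_theta13LiveOfFamily₂_iff,
    show eps29OfFamily eps0OfRecord₁₃ = 1 / 8 by rw [eps29OfFamily_eq]; unfold eps0OfRecord₁₃; norm_num]

variable {c₀} in
/-- **THE LOCATED NEGATIVE (dag-ref-D READ-148's kernel certificate, by name)**: at the pinned member of record `θ₁₃(1, ⅛)` N1 at the FAITHFUL letters FAILS for every residual with
`A₁·K₀(c₀) ≥ 1` (`K₀(c₀) = 2C₁α₄⁻¹α₆⁻¹M^q e^{C₂κ₁}`): `2(F.L+2)⁴ ≥ 2·13⁴`, `e^{100001} ≥ 1`, `K₀(64,8) ≥ 1` make the small row's left side `≥ 2·13⁴·576∕8 > 1`.  So a (D4) ∕ N26 ∕ K2‴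
theorem hypothesised on that `CondsL` AT `theta13LiveOfRecord` would be vacuous — the reason §1 ∕ §3 live at the open-letter family (the ₁₃ twin of p479720's
`not_condsL_c13OfRecord₁₂_theta12OfRecord`; nothing at the family is voided, §1b). [cite: Balaban1988RG2Cluster, p.7 (after (1.21)) and p.21 (after (2.39)); Balaban1987RG1, (1.2) p.260 and (2.9) p.266] -/
theorem not_condsL_faithful_theta13LiveOfRecord (hAK : 1 ≤ c₀.A₁ * c₀.K₀) :
    ¬ CondsL 4 (c13OfRecord₁₂ F N (theta13LiveOfRecord F N).toStage12Params { c₀ with ε₁ := (theta13LiveOfRecord F N).ε₂₉ })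
        (((c13OfRecord₁₂ F N (theta13LiveOfRecord F N).toStage12Params { c₀ with ε₁ := (theta13LiveOfRecord F N).ε₂₉ }).L : ℝ) / 2) := by
  rw [condsL_faithful_theta13LiveOfRecord_iff]
  rintro ⟨h, -⟩
  have hL : (12 : ℝ) ≤ (F.L : ℝ) := by exact_mod_cast F.hL11
  have hL4 : (14 : ℝ) ^ 4 ≤ ((F.L : ℝ) + 2) ^ 4 := by gcongr; linarith
  have hE : 1 ≤ Real.exp (5 * 20000 + 1) := Real.one_le_exp (by norm_num)
  have hK := one_le_K₀_64_8
  have h1 : (14 : ℝ) ^ 4 * 1 * 1 * 1 ≤ ((F.L : ℝ) + 2) ^ 4 * (c₀.A₁ * c₀.K₀) * Real.exp (5 * 20000 + 1) * K₀ 64 8 := by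
    gcongr
  have e : 2 * ((F.L : ℝ) + 2) ^ 4 * c₀.A₁ * c₀.K₀ * (1 / 8) * Real.exp (5 * 20000 + 1) * K₀ 64 8 * 9 * 64 =
      144 * (((F.L : ℝ) + 2) ^ 4 * (c₀.A₁ * c₀.K₀) * Real.exp (5 * 20000 + 1) * K₀ 64 8) := by ring
  rw [e] at h
  nlinarith

end RecordMember

/-! ## §2 The ALL-NUMERICS family `θ₁₃(n, ε₂₉) = theta13LiveOfNumerics F N n ε₂₉ ζ Rz Zt`: N1 at the faithful letters given the κ threshold on `n` -/

section AllNumerics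

variable (n : Stage12Numerics) (ε₂₉ : ℝ) (ζ : ZetaOfRecord F N n.ν n.τ9.M) (Rz : (K : ℕ) → Sect2.Residual (F.P K) (MatA N))
  (Zt : (K : ℕ) → TkResidualW F N (FluctV N) K) (c₀ : B13.Consts)

/-- **Face: Lemma 3's activity constant at the letters of record OF `θ₁₃(n, ε₂₉)`**: `C₃ = 2(F.L+2)⁴·A₁·(E₀(n)·K₀(c₀))` with `E₀(n) = n.s2.lf.E₀` the numerics' (I.1.18) constant.
[cite: Balaban1988RG2Cluster, p.20 (definition of C₃) and p.21 («we define ½E₀ as equal to this constant»); Balaban1987RG1, (0.1) p.251] -/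
theorem C3act_c13OfRecord₁₂_theta13LiveOfNumerics :
    (c13OfRecord₁₂ F N (theta13LiveOfNumerics F N n ε₂₉ ζ Rz Zt).toStage12Params c₀).C3act =
      2 * ((F.L : ℝ) + 2) ^ 4 * c₀.A₁ * (n.s2.lf.E₀ * c₀.K₀) := by
  rw [C3act_c13OfRecord₁₂, show (theta13LiveOfNumerics F N n ε₂₉ ζ Rz Zt).toStage12Params.ℓ₆ + 1 = F.L from stage3OfFamily_ℓ₆_succ F,
    show (theta13LiveOfNumerics F N n ε₂₉ ζ Rz Zt).toStage12Params.s2 = n.s2 from rfl]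

variable {n} in
/-- **N1 AT THE FAITHFUL LETTERS OF THE ALL-NUMERICS MEMBER `θ₁₃(n, ε₂₉)` GIVEN THE κ THRESHOLD ON `n`**: `20·(64·log 162 + 1) ≤ n.s2.lf.κ` pays both κ rows (p485881, for every
block size `≥ 3`); left: the small row in `(F.L, E₀(n), κ(n), A₁, K₀(c₀), ε₂₉)` and the `A₂` row — the form a numerics `n` keyed to print's undetermined constants instantiates.
[cite: Balaban1988RG2Cluster, p.7 (after (1.21)), p.21 (after (2.39) and after (2.41)); Balaban1987RG1, (1.18) p.263 and (2.9) p.266] -/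
theorem condsL_faithful_theta13LiveOfNumerics_iff_of_kappa_ge (hκ : 20 * (64 * Real.log 162 + 1) ≤ n.s2.lf.κ) :
    CondsL 4 (c13OfRecord₁₂ F N (theta13LiveOfNumerics F N n ε₂₉ ζ Rz Zt).toStage12Params { c₀ with ε₁ := ε₂₉ })
        (((c13OfRecord₁₂ F N (theta13LiveOfNumerics F N n ε₂₉ ζ Rz Zt).toStage12Params { c₀ with ε₁ := ε₂₉ }).L : ℝ) / 2) ↔
      2 * ((F.L : ℝ) + 2) ^ 4 * c₀.A₁ * (n.s2.lf.E₀ * c₀.K₀) * ε₂₉ * Real.exp (5 * n.s2.lf.κ + 1) * K₀ 64 8 * 9 * 64 ≤ 1 ∧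
        Real.exp 1 * 9 * 64 * K₀ 64 8 ^ 2 ≤ c₀.A₂ := by
  have hκ' : 20 * (64 * Real.log 162 + 1) ≤ (theta13LiveOfNumerics F N n ε₂₉ ζ Rz Zt).toStage12Params.s2.lf.κ := hκ
  rw [condsL_c13OfRecord₁₂_half_iff_of_kappa_ge F N _ _ hκ',
    show (c13OfRecord₁₂ F N (theta13LiveOfNumerics F N n ε₂₉ ζ Rz Zt).toStage12Params { c₀ with ε₁ := ε₂₉ }).C3act =
        (c13OfRecord₁₂ F N (theta13LiveOfNumerics F N n ε₂₉ ζ Rz Zt).toStage12Params c₀).C3act from rfl,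
    C3act_c13OfRecord₁₂_theta13LiveOfNumerics, show (theta13LiveOfNumerics F N n ε₂₉ ζ Rz Zt).toStage12Params.s2 = n.s2 from rfl]

end AllNumerics

/-! ## §3 The (D4) family road AT THE FAMILY WITNESS `θ₁₃(ε₀, ε₂₉)`: B4 ∕ N26 at `betaOfRecord₁₃ θ₁₃(ε₀, ε₂₉)` with N1 discharged modulo the displayed `hsmall`, `hA₂` -/

section RoadAtFamily

variable {γ₀ : ℝ} {M : ℕ} [NeZero M] {μ ν : Fin 4} {α₂ : ℝ} {q : Consts190}
variable (ε₀ ε₂₉ : ℝ) (ζ : ZetaOfRecord F N (numerics7OfFamily ε₀) 1) (Rz : (K : ℕ) → Sect2.Residual (F.P K) (MatA N))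
  (Zt : (K : ℕ) → TkResidualW F N (FluctV N) K) (c₀ : B13.Consts)
  (lamF : ResidB13Fam₁₂ F N (theta13LiveOfFamily₂ F N ε₀ ε₂₉ ζ Rz Zt).toStage12Params) (hle : γ₀ ≤ 1 / 2)
  -- the leaf kernels and the (1.22) identification AT THE STAGE-13 MERGED β OF THE MEMBER on the box
  (A1 : (k : ℕ) → (Fin (k + 1) → ℝ) → LDom 4 → Pt 4 → ℝ)
  (hm : letI := (theta13LiveOfFamily₂ F N ε₀ ε₂₉ ζ Rz Zt).instVβ₁; letI := (theta13LiveOfFamily₂ F N ε₀ ε₂₉ ζ Rz Zt).instVβ₂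
    letI := (theta13LiveOfFamily₂ F N ε₀ ε₂₉ ζ Rz Zt).instιβ
    ∀ k (v : Fin (k + 1) → ℝ), v ∈ Box γ₀ k →
      betaMerged F (mergedTermFamilyMatT F N (TcanOfRecord F N)
          (chiFixed29 F N (theta13LiveOfFamily₂ F N ε₀ ε₂₉ ζ Rz Zt).ν (theta13LiveOfFamily₂ F N ε₀ ε₂₉ ζ Rz Zt).ε₂₉)
          (theta13LiveOfFamily₂ F N ε₀ ε₂₉ ζ Rz Zt).εbg) (theta13LiveOfFamily₂ F N ε₀ ε₂₉ ζ Rz Zt).ρ8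
          (theta13LiveOfFamily₂ F N ε₀ ε₂₉ ζ Rz Zt).bV k v =
        beta0OfMerged (betaMerged F (mergedTermFamilyMatT F N (TcanOfRecord F N)
            (chiFixed29 F N (theta13LiveOfFamily₂ F N ε₀ ε₂₉ ζ Rz Zt).ν (theta13LiveOfFamily₂ F N ε₀ ε₂₉ ζ Rz Zt).ε₂₉)
            (theta13LiveOfFamily₂ F N ε₀ ε₂₉ ζ Rz Zt).εbg) (theta13LiveOfFamily₂ F N ε₀ ε₂₉ ζ Rz Zt).ρ8
            (theta13LiveOfFamily₂ F N ε₀ ε₂₉ ζ Rz Zt).bV) (theta13LiveOfFamily₂ F N ε₀ ε₂₉ ζ Rz Zt).v₀ k +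
          B12Beta.secondMoment (fun _ _ => limKernel (A1 k v)) μ ν)
  -- N10's in-edge in the FAMILY currency at every run and the member letters law on the box, AT THE FAITHFUL LETTERS OF THE MEMBER
  (hcF : ∀ P k v, v ∈ Box γ₀ k →
    (lamF P k v).c = c13OfRecord₁₂ F N (theta13LiveOfFamily₂ F N ε₀ ε₂₉ ζ Rz Zt).toStage12Params { c₀ with ε₁ := ε₂₉ })
  (hleafF : ∀ P, B13FamLeafOfRecord₁₂ F N (theta13LiveOfFamily₂ F N ε₀ ε₂₉ ζ Rz Zt).toStage12Params { c₀ with ε₁ := ε₂₉ } lamF P)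
  -- per (scale, history) IN THE BOX: a run sequence whose families' members AT THAT HISTORY have growing coarse tori, their laws and restriction sentences
  (Ps : (k : ℕ) → (Fin (k + 1) → ℝ) → ℕ → B12.RunParams)
  (hn : ∀ k v, v ∈ Box γ₀ k → Tendsto (fun m => (lamF (Ps k v m) k v).n) atTop atTop)
  (hsp : ∀ k v, v ∈ Box γ₀ k → ∀ m, SpLaw (lamF (Ps k v m) k v)) (h213 : ∀ k v, v ∈ Box γ₀ k → ∀ m, Law213 (lamF (Ps k v m) k v))
  (hR : ∀ k v, v ∈ Box γ₀ k → ∀ m, (lamF (Ps k v m) k v).Restr)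
  -- N1's two residual rows DISPLAYED as inequalities (the open letter below the threshold; the printed O(1) of (2.41)), N3 at the faithful letters
  (hsmall : 2 * ((F.L : ℝ) + 2) ^ 4 * c₀.A₁ * c₀.K₀ * ε₂₉ * Real.exp (5 * 20000 + 1) * K₀ 64 8 * 9 * 64 ≤ 1)
  (hA₂ : Real.exp 1 * 9 * 64 * K₀ 64 8 ^ 2 ≤ c₀.A₂)
  (hs : SignsL (c13OfRecord₁₂ F N (theta13LiveOfFamily₂ F N ε₀ ε₂₉ ζ Rz Zt).toStage12Params { c₀ with ε₁ := ε₂₉ }) α₂ q.B₃)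
  -- the (4.4) seams with holomorphic activities, the (190) data, the (1.7) ∕ test-vector-limit data with the read-out of the leaf kernels (on the box)
  (Wn : (k : ℕ) → (Fin (k + 1) → ℝ) → ℕ → Type) (instW : ∀ k v m, NormedAddCommGroup (Wn k v m))
  (instWs : ∀ k v m, NormedSpace ℂ (Wn k v m))
  (emb : (k : ℕ) → (v : Fin (k + 1) → ℝ) → (m : ℕ) → TDom 4 ((lamF (Ps k v m) k v).n + 1) → Wn k v m → (lamF (Ps k v m) k v).Φ)
  (hemb : ∀ k v, v ∈ Box γ₀ k → ∀ m X, ∀ u ∈ ball (0 : Wn k v m) α₂, emb k v m X u ∈ (lamF (Ps k v m) k v).sp2 X)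
  (hH : ∀ k v, v ∈ Box γ₀ k → ∀ m (X Z : TDom 4 ((lamF (Ps k v m) k v).n + 1)), Z.1 ⊆ X.1 →
    DifferentiableOn ℂ (fun u => (lamF (Ps k v m) k v).H Z (emb k v m X u)) (ball 0 α₂))
  (D : (k : ℕ) → (v : Fin (k + 1) → ℝ) → Data190 4 M (NOfLayers fun m => lamF (Ps k v m) k v) (Wn k v) q)
  (V : (k : ℕ) → (Fin (k + 1) → ℝ) → LDom 4 → Type) (instV : ∀ k v Y, NormedAddCommGroup (V k v Y))
  (instVs : ∀ k v Y, NormedSpace ℂ (V k v Y))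
  (Fw : (k : ℕ) → (v : Fin (k + 1) → ℝ) → (Y : LDom 4) → V k v Y → ℂ)
  (hFd : ∀ k v, v ∈ Box γ₀ k → ∀ Y, ∃ ρ > 0, DifferentiableOn ℂ (Fw k v Y) (ball 0 ρ))
  (r : (k : ℕ) → (v : Fin (k + 1) → ℝ) → (m : ℕ) → (Y : LDom 4) → Wn k v m →L[ℂ] V k v Y)
  (hfac : ∀ k v, v ∈ Box γ₀ k → ∀ Y : LDom 4, ∀ᶠ m in atTop, ∀ u ∈ ball (0 : Wn k v m) α₂,
    (lamF (Ps k v m) k v).Ek1 (tproj ((lamF (Ps k v m) k v).n + 1) Y) (emb k v m (tproj ((lamF (Ps k v m) k v).n + 1) Y) u) =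
      Fw k v Y (r k v m Y u))
  (t : (k : ℕ) → (v : Fin (k + 1) → ℝ) → (Y : LDom 4) → Pt 4 → V k v Y)
  (hconv : ∀ k v, v ∈ Box γ₀ k → ∀ (Y : LDom 4) (x : Pt 4),
    Tendsto (fun m => r k v m Y ((D k v).hn m (tproj ((lamF (Ps k v m) k v).n + 1) Y) (proj (((lamF (Ps k v m) k v).n + 1) * M) x)))
      atTop (𝓝 (t k v Y x)))
  (ha : ∀ k v, v ∈ Box γ₀ k → ∀ (Y : LDom 4) (z : Pt 4), A1 k v Y z = (mixedDeriv (Fw k v Y) (t k v Y 0) (t k v Y z)).re)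

include hle hm hcF hleafF hn hsp h213 hR hsmall hA₂ hs instW instWs hemb hH hFd hfac hconv ha

/-- **B4 ON THE BOX `]0, γ₀]^{k+1}`, `γ₀ ≤ ½`, AT THE STAGE-13 β OF THE FAMILY WITNESS `θ₁₃(ε₀, ε₂₉)` FROM THE FAMILY ROAD + (C-pt), N1 DISCHARGED MODULO `hsmall`, `hA₂`**
(p491248 `betaContH_betaOfRecord₁₃_of_family` at `θ := θ₁₃(ε₀, ε₂₉)`, faithful letters, `hC := condsL_faithful_theta13LiveOfFamily₂_of_eps_le hsmall hA₂`, `θ₁₃.γ = ½` `rfl`).  What the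
(D4) ∕ N26 consumer instantiates AT NODE 00's family, the `ε₂₉`-inequality displayed (K0a FILE 9).  Instance 0∕1: the family of record, the (1.22) identification at the ₁₃ merged β,
the laws, the seams, the (190) ∕ (1.7) data, N3 and (C-pt) are displayed HYPOTHESES. [cite: Balaban1987RG1, (1.7) p.261, (1.20)-(1.22) p.264, (2.9) p.266 and (5.10) p.293; Balaban1988RG2Cluster, Lemma 3 (2.38) p.20 and p.21; Balaban1985Variational, (190) p.308] -/
theorem betaContH_betaOfRecord₁₃_theta13LiveOfFamily₂_of_family
    (hq : q.Valid (c13OfRecord₁₂ F N (theta13LiveOfFamily₂ F N ε₀ ε₂₉ ζ Rz Zt).toStage12Params { c₀ with ε₁ := ε₂₉ }).δ₀)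
    (hcpt : ∀ k (x : Pt 4), ContinuousOn (fun v : Fin (k + 1) → ℝ => limKernel (A1 k v) x) (Box γ₀ k)) :
    BetaContH γ₀ (betaOfRecord₁₃ F N (theta13LiveOfFamily₂ F N ε₀ ε₂₉ ζ Rz Zt)) :=
  betaContH_betaOfRecord₁₃_of_family F N (theta13LiveOfFamily₂ F N ε₀ ε₂₉ ζ Rz Zt) { c₀ with ε₁ := ε₂₉ } lamF
    (by rw [theta13LiveOfFamily₂_γ]; exact hle) A1 hm hcF hleafF Ps hn hsp h213 hR
    (condsL_faithful_theta13LiveOfFamily₂_of_eps_le F N ε₀ ζ Rz Zt hsmall hA₂) hs Wn instW instWs emb hemb hH D V instV instVs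
    Fw hFd r hfac t hconv ha hq hcpt

/-- **N26 AT THE DATUM OF RECORD OF THE FAMILY WITNESS `θ₁₃(ε₀, ε₂₉)` FROM THE FAMILY ROAD + (C-pt)** on a box `0 < γ₀ ≤ ½` (`βfun_datumOfRecord₁₃`, `rfl`): `∃ γc > 0, BetaContH γc
(datumOfRecord₁₃ θ₁₃(ε₀, ε₂₉) hP).βfun`, N1 discharged modulo `hsmall`, `hA₂`.  Instance 0∕1; N26 NOT discharged; the Stage-13 provisos `hP` at the member displayed (K0a:
`provisos₁₃_theta13LiveOfFamily₂_of_bg`, row P11). [cite: Balaban1987RG1, (1.7) p.261, (1.20)-(1.22) p.264, (2.9) p.266, (4.4) p.281 and (5.10) p.293; Balaban1988RG2Cluster, p.15, Lemma 3 (2.38) p.20 and p.21; Balaban1985Variational, (190) p.308] -/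
theorem n26_datumOfRecord₁₃_theta13LiveOfFamily₂_of_family (hP : (theta13LiveOfFamily₂ F N ε₀ ε₂₉ ζ Rz Zt).Provisos₁₃ F N)
    (hq : q.Valid (c13OfRecord₁₂ F N (theta13LiveOfFamily₂ F N ε₀ ε₂₉ ζ Rz Zt).toStage12Params { c₀ with ε₁ := ε₂₉ }).δ₀)
    (hcpt : ∀ k (x : Pt 4), ContinuousOn (fun v : Fin (k + 1) → ℝ => limKernel (A1 k v) x) (Box γ₀ k)) (hγ₀ : 0 < γ₀) :
    ∃ γc : ℝ, 0 < γc ∧ BetaContH γc (datumOfRecord₁₃ F N (theta13LiveOfFamily₂ F N ε₀ ε₂₉ ζ Rz Zt) hP).βfun :=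
  ⟨γ₀, hγ₀, betaContH_betaOfRecord₁₃_theta13LiveOfFamily₂_of_family F N ε₀ ε₂₉ ζ Rz Zt c₀ lamF hle A1 hm hcF hleafF Ps hn hsp h213 hR hsmall
    hA₂ hs Wn instW instWs emb hemb hH D V instV instVs Fw hFd r hfac t hconv ha hq hcpt⟩

end RoadAtFamily

end Summit.QuantumFields.YangMills.Theorems.BalabanUVNodesN26AtRecord13Family

end
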